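import Literature.MathematicalPhysics.QuantumFieldTheory.Balaban1983to89.Node00.Record13SepCoPH

/-!
# NODE 00 (YM-PLAN Track A) — RECORD 13, §11 (v1.8 `SepCoPHV`): THE VERSION SLOT — the Stage-13 datum of record with its level-`k ≥ 1`
# densities RE-CHOSEN WITHIN THEIR `dV`-a.e. CLASSES (director-ym №210 (A)(1) «(δ) NULL-SET SURGERY, DEF-LEVEL FIRST»; pub-ymgap-plan
# WORD-3 ∕ WORD-3b page `D84-REV26R/WORD-3-version-pin.md` §3 (δ) ∕ §6 (δⱽ)) — keyed on FILE 28T `Node00/Record13SepCoPH.lean`, AS A SIBLING MODULE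

WHY (located, kernel): at the v1.7 record `datumOfRecord₁₃SepCoPH F N θ h` the level-`(k+1)` density carries the factor
`avgDensity (avOfRecord F N P.K k).avg V = (Measure.rnDeriv ((dU_k).map Ū) dV_{k+1} V).toNNReal` — a `Classical.choose` VERSION determined only
`dV`-a.e. — while [III] Cor. 3 (2.50) `B16.Cor3With` is typed POINTWISE at every field `V`; so the (B) Cor-3 half of the rung's K1 item at levels `≥ 1` pins
a point value no estimate delivers and `dV`-a.e.-equal versions with either truth value exist (Summits-side certificates `…K1VersionPinAtRecord13` p610399,
`…N13Cor3MargDensityVersionNotDeterminedAtRecord13` p617654, `…K1R8VersionPinOnNullUnitFibre` p618356).  CLASS «misstated by inheritance (display currency)»;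
REPAIR = this def-level object first, route second (№210).

WHAT THIS MODULE IS.  §1 (generic, any machine core `M`, any averaging family `av`): `TowerRevision τ` — a RE-CHOICE of an explicit density tower's densities
at every POSITIVE level within their `dV`-a.e. classes, LEVEL 0 KEPT VERBATIM (the Wilson start `e^{−E}·exp(−A/g₀²)` is an explicit continuous function and
`Tower.rho_zero` ∕ `Realisation.rho_zero` pin it as a FUNCTION) — and `TowerRevision.tower v : M.Tower av`, the revised tower: `ρ := v.ρ`, `Trho := τ.Trho`
UNCHANGED, and the three displayed obligations TRANSPORTED, no estimate: `rho_zero` by the level-0 equation, `isRT_Trho` because `Setup.IsRT` reads its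
SOURCE density under `∫ · dU` (law-level: `isRT_congr_ae_source`), `integral_succ` by `integral_congr_ae`.  Hence NO TOWER RE-RUN: in the tower datum
`Realisation.rho_succ_eq : ρ_{k+1} = R(Tρ_k)` holds BY CONSTRUCTION for whatever `ρ_{k+1}` the tower carries (`R := Tower.inducedR`, `inducedR_Trho`), and
`RGMachineCore.construction ρ` puts `ρ` in the `ρ` field ONLY — `flow`, `Cfg`, `toB12`, `χ`, `Sect2Form`, the actions are byte-identical
(`TowerRevision.toB12_datum_tower`, `rfl`).  §2 (the record, any `N`, `θ : Stage13HParams F N`, `h : θ.Provisos₁₃SepCoPH F N` — the v1.7 provisos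
UNCHANGED, no proviso row added or dropped): `Revision₁₃ F N θ h := TowerRevision (towerOfRecord₁₃SepCoPH F N θ h)`, the revised tower ∕ datum
`towerOfRecord₁₃SepCoPHV` ∕ `datumOfRecord₁₃SepCoPHV F N θ h v := datumOfTower F N (coreOfRecord₁₃CoPH F N θ) v.tower`, the DOOR
`datumOfRecord₁₃SepCoPHV F N θ h (Revision₁₃.refl F N θ h) = datumOfRecord₁₃SepCoPH F N θ h` (`rfl` — structure eta), and the `rfl` ∕ `Iff.rfl` face family:
`av`, `IsDatumOfRecord₀`, B1, `C` (= `construction v.ρ` = the v1.7 construction with its `ρ` field UPDATED run by run — dag-n13-w2's `{C P with ρ := ρ′ P}` shape),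
`toB12` (= the record's, EVERY `v`: `DagBinding.EndpointExistence` is version-free — K2's item untouched), `βfun`, flow, `dens` (= `v.ρ`; `=` the record's at
level 0, `=ᵐ` at levels `≥ 1`), `Trho`, `R(Tρ_k) = v.ρ_{k+1}`, χ ∕ actions ∕ `IndAss` ∕ `Repr`, `Sect2Form` and `B16.Thm1Printed` (the record's CLAUSE, every
`v` — Theorem 1 speaks of θ's represented densities), `Tuned`, `scheme` (reads `av` only), `UnderHypotheses` ∕ `T4ApexHybrid.HybridNE7Under` (BODY written at
the record datum — version-free; ANTECEDENT = (B) POINTWISE at the revised datum, which is why the rung's K3 item is keyed AT the slot), the ADAPTERS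
`exists_revision₁₃_of_exists_update` (construction-update form: «∃ ρ′: level-0 equation ∧ positive-level a.e. (`k + 1 ≤ K`) ∧ Q of the updated construction» ⇒
«∃ v, Q (datumOfRecord₁₃SepCoPHV … v).C», any `Q : B16.Construction → Prop`) ∕ `exists_revision₁₃_of_exists_tower` (tower form: «∃ τ′ : Tower, same two agreements ∧
Q (construction τ′.ρ)» ⇒ the same); with `Q := B16.EndStatementBPrinted` either is the revised K1 (B)-conjunct `∃ v, B16.EndStatementBPrinted (datumOfRecord₁₃SepCoPHV F 2 θ h v).C`
from a B16-level «(B) a.e. ⇒ (B) as typed up to an a.e. re-choice keeping level 0» lemma — the Summits-side suppliers' lane, NOT here — and the T⁴ apex at the revised datum.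

INTERFACE POINT (for the a.e.⇄pointwise supplier): the slot NEVER re-chooses level 0; a re-choice lemma feeding the adapter keeps `ρ′ P 0 = (C P).ρ 0` (re-choose
only where (2.50) fails — at level 0 it fails nowhere once proved pointwise for the explicit Wilson start) or takes the level-0 inequality pointwise as a hypothesis.

HONEST FRAMING.  Definitions and `rfl` ∕ `Iff.rfl` ∕ `integral_congr_ae` bookkeeping of record — a faithfulness-of-CURRENCY repair slot for ONE face of a DATUM of a
CONDITIONAL record; NOTHING of Bałaban is asserted ((B), [V] Thm 1, [III] Cor. 3, (C), [B8] Thm 2 remain hypotheses ∕ sockets ∕ unproved in print); NO new `B16`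
predicate (the a.e. currency of (2.50) is the supplier's, Summits-side); no route item is touched here — pub-ymgap-plan re-keys K1 ∕ K3 (+ `closes`) ONCE on the names
below by a director-pressed deprecate-and-add revision (№210 (A)(2)); a re-key is not progress; counts UNMOVED (typed 28∕28 · discharged 5∕27); one finite 𝕋⁴
programme at fixed `ε = L^{−K}` — NOT the continuum ∕ ℝ⁴ ∕ OS ∕ mass-gap ∕ Clay statement.  No instance, no notation, no attribute; nothing landed is edited.
References: [III] = Balaban1988Convergent, [IV] = Balaban1989LargeFieldI, [V] = Balaban1989LargeFieldII, [B7] = Balaban1985Averaging, [B8] = Balaban1987RG1.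
-/

noncomputable section

open MeasureTheory

namespace Literature.MathematicalPhysics.QuantumFieldTheory.Balaban1983to89.Node00

open T4Continuum AveragingRT T4FiniteEpsInhabited FlowStep FlowStepRuns DagBinding T4DatumAssembly

/-! ## §1. Re-choosing an explicit density tower within its a.e. classes at the positive levels (generic core, generic averaging family) -/

section Generic

variable {F : T4Family} {G : Type} [GaugeGroup G] [MeasurableSpace G] [HaarData G]

/-- `Setup.IsRT` transfers along an a.e.-equality of the SOURCE density: the push-forward identity reads `ρ` only under `∫ · dU` (law-level). [cite: Balaban1985Averaging, (10) p.19 (bookkeeping)] -/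
theorem isRT_congr_ae_source {P : Params} {j : ℕ} {avg : GaugeField P j G → GaugeField P (j + 1) G} {ρ ρ₁ : Density P j G}
    {ρ' : Density P (j + 1) G} (h : IsRT avg ρ ρ') (h1 : ρ₁ =ᵐ[fieldMeasure P j G] ρ) : IsRT avg ρ₁ ρ' := by
  intro f hf hbd
  rw [h f hf hbd]
  refine integral_congr_ae ?_
  filter_upwards [h1] with U hU
  rw [hU]

variable {M : RGMachineCore F G} {av : (K j : ℕ) → Averaging (F.P K) j G}

/-- **A REVISION OF AN EXPLICIT DENSITY TOWER** `τ` (director-ym №210 (A)(1) «(δ) null-set surgery»): a density family `ρ` agreeing with the tower's AS A FUNCTION at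
level `0` (the Wilson start — never re-chosen) and `dV`-a.e. at every positive level the run reads, `1 ≤ k + 1 ≤ K` (the levels `Tower`'s obligations and
[III] Cor. 3 quantify over; beyond `K` nothing is asked).  DATA; `refl` inhabits it. [cite: Balaban1988Convergent, (0.2) p.244, Cor. 3 (2.50) p.264 (bookkeeping: the version class of the typed densities)] -/
structure TowerRevision (τ : M.Tower av) where
  /-- the re-chosen densities `ρ_k` of the run `p` -/
  ρ : (p : B12.RunParams) → (k : ℕ) → Density (F.P p.K) k G
  /-- level `0` is the tower's, verbatim -/
  rho_zero_eq : ∀ p : B12.RunParams, ρ p 0 = τ.ρ p 0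
  /-- every positive level the run reads (`k + 1 ≤ K`) agrees with the tower's `dV`-almost everywhere -/
  ae_eq_succ : ∀ (p : B12.RunParams) (k : ℕ), k < p.K → ρ p (k + 1) =ᵐ[fieldMeasure (F.P p.K) (k + 1) G] τ.ρ p (k + 1)

namespace TowerRevision

variable (τ : M.Tower av)

/-- The trivial revision: the tower's own densities. [cite: Balaban1988Convergent, (0.2) p.244 (bookkeeping)] -/
def refl : TowerRevision τ where
  ρ := τ.ρ
  rho_zero_eq := fun _ => rfl
  ae_eq_succ := fun _ _ _ => Filter.EventuallyEq.rfl

/-- A revision from re-chosen densities `σ p k` at the POSITIVE levels `k + 1` only (level `0` := the tower's, definitionally). [cite: Balaban1988Convergent, (0.2) p.244 (bookkeeping)] -/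
def ofSucc (σ : (p : B12.RunParams) → (k : ℕ) → Density (F.P p.K) (k + 1) G)
    (hσ : ∀ (p : B12.RunParams) (k : ℕ), k < p.K → σ p k =ᵐ[fieldMeasure (F.P p.K) (k + 1) G] τ.ρ p (k + 1)) : TowerRevision τ where
  ρ := fun p k => match k with
    | 0 => τ.ρ p 0
    | k + 1 => σ p k
  rho_zero_eq := fun _ => rfl
  ae_eq_succ := hσ

/-- A revision from a density family agreeing with the tower's a.e. at EVERY level (unguarded supplier currency) and AS A FUNCTION at level `0`. [cite: Balaban1988Convergent, (0.2) p.244 (bookkeeping)] -/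
def ofAE (ρ : (p : B12.RunParams) → (k : ℕ) → Density (F.P p.K) k G) (h0 : ∀ p : B12.RunParams, ρ p 0 = τ.ρ p 0)
    (hae : ∀ (p : B12.RunParams) (k : ℕ), ρ p k =ᵐ[fieldMeasure (F.P p.K) k G] τ.ρ p k) : TowerRevision τ :=
  ⟨ρ, h0, fun p k _ => hae p (k + 1)⟩

variable {τ} (v : TowerRevision τ)

/-- `refl`'s densities are the tower's (`rfl`). [cite: Balaban1988Convergent, (0.2) p.244 (bookkeeping)] -/
theorem refl_ρ : (refl τ).ρ = τ.ρ := rfl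

/-- `ofSucc`'s positive-level densities are the given ones (`rfl`). [cite: Balaban1988Convergent, (0.2) p.244 (bookkeeping)] -/
theorem ofSucc_ρ_succ (σ : (p : B12.RunParams) → (k : ℕ) → Density (F.P p.K) (k + 1) G)
    (hσ : ∀ (p : B12.RunParams) (k : ℕ), k < p.K → σ p k =ᵐ[fieldMeasure (F.P p.K) (k + 1) G] τ.ρ p (k + 1)) (p : B12.RunParams) (k : ℕ) :
    (ofSucc τ σ hσ).ρ p (k + 1) = σ p k := rfl

/-- A revision agrees with the tower a.e. at every level `k ≤ K` (equality at level `0`). [cite: Balaban1988Convergent, (0.2) p.244 (bookkeeping)] -/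
theorem ae_eq (p : B12.RunParams) : ∀ k : ℕ, k ≤ p.K → v.ρ p k =ᵐ[fieldMeasure (F.P p.K) k G] τ.ρ p k
  | 0, _ => by rw [v.rho_zero_eq p]
  | k + 1, hk => v.ae_eq_succ p k (Nat.lt_of_succ_le hk)

/-- **THE REVISED TOWER**: densities `v.ρ`, the SAME explicit `Tρ_k`, and the three displayed obligations transported — `rho_zero` by the level-`0` equation, the
push-forward identity along the source a.e.-equality (`isRT_congr_ae_source`), (0.4) at the step by `integral_congr_ae`.  No estimate; no tower re-run. [cite: Balaban1988Convergent, (0.2) p.244; Balaban1985Averaging, (10) p.19; Balaban1989LargeFieldI, (0.4) p.176 (bookkeeping)] -/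
def tower : M.Tower av where
  ρ := v.ρ
  Trho := τ.Trho
  rho_zero := fun p => (v.rho_zero_eq p).trans (τ.rho_zero p)
  isRT_Trho := fun p k hk => isRT_congr_ae_source (τ.isRT_Trho p k hk) (v.ae_eq p k hk.le)
  integral_succ := fun p k hk => (integral_congr_ae (v.ae_eq_succ p k hk)).trans (τ.integral_succ p k hk)

/-- The revised tower's densities are `v.ρ` (`rfl`). [cite: Balaban1988Convergent, (0.2) p.244 (bookkeeping)] -/
theorem tower_ρ : v.tower.ρ = v.ρ := rfl

/-- Its `Tρ_k` are the tower's, verbatim (`rfl`). [cite: Balaban1988Convergent, (3.25) p.270 (bookkeeping)] -/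
theorem tower_Trho : v.tower.Trho = τ.Trho := rfl

/-- **THE DOOR (generic)**: revising by `refl` returns the tower itself (`rfl` — structure eta and proof irrelevance). [cite: Balaban1988Convergent, (0.2) p.244 (bookkeeping)] -/
theorem tower_refl : (refl τ).tower = τ := rfl

/-- `R(Tρ_k) = v.ρ_{k+1}` for the revised tower's induced operation. [cite: Balaban1988Convergent, (0.2) p.244; Balaban1989LargeFieldI, (0.3) p.176 (bookkeeping)] -/
theorem inducedR_tower_Trho (p : B12.RunParams) (k : ℕ) : v.tower.inducedR p k (τ.Trho p k) = v.ρ p (k + 1) :=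
  v.tower.inducedR_Trho p k

/-- The revised tower's datum has the construction of the core over `v.ρ` (`rfl`). [cite: Balaban1989LargeFieldII, Thm 1 + (0.1) pp.355–356 (bookkeeping)] -/
theorem datum_tower_C : v.tower.datum.C = M.construction v.ρ := rfl

/-- … which IS the original datum's construction with its `ρ` field UPDATED run by run (`rfl`) — the `{C P with ρ := ρ′ P}` shape of a B16-level re-choice. [cite: Balaban1989LargeFieldII, Thm 1 + (0.1) pp.355–356 (bookkeeping)] -/
theorem datum_tower_C_eq_update : v.tower.datum.C = fun P => { τ.datum.C P with ρ := v.ρ P } := rfl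

/-- The small-field part `toB12` is UNCHANGED by a revision (`rfl`) — `DagBinding.EndpointExistence` and every flow-side statement read the same term. [cite: Balaban1987RG1, Thm 1 p.256 (bookkeeping)] -/
theorem toB12_datum_tower : v.tower.datum.C.toB12 = τ.datum.C.toB12 := rfl

/-- The averaging maps are unchanged (`rfl`). [cite: Balaban1987RG1, (0.4) p.253 (bookkeeping)] -/
theorem datum_tower_av : v.tower.datum.av = τ.datum.av := rfl

/-- The β-functions are unchanged (`rfl`). [cite: Balaban1987RG1, (1.22) p.264 (bookkeeping)] -/
theorem datum_tower_βfun : v.tower.datum.βfun = τ.datum.βfun := rfl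

/-- The revised datum's transported densities ARE `v.ρ` (`rfl`). [cite: Balaban1988Convergent, (0.2) p.244 (bookkeeping)] -/
theorem dens_datum_tower (K : ℕ) (g₀ : ℝ) (k : ℕ) : v.tower.datum.dens K g₀ k = v.ρ ⟨K, F.m, g₀⟩ k := rfl

/-- … and agree with the original datum's a.e. at every level `k ≤ K`. [cite: Balaban1988Convergent, (0.2) p.244 (bookkeeping)] -/
theorem dens_datum_tower_ae (K : ℕ) (g₀ : ℝ) (k : ℕ) (hk : k ≤ K) :
    v.tower.datum.dens K g₀ k =ᵐ[fieldMeasure (F.P K) k G] τ.datum.dens K g₀ k :=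
  v.ae_eq ⟨K, F.m, g₀⟩ k hk

/-- A revision of an integrable tower is integrable (`Integrable.congr`). [cite: Balaban1988Convergent, (0.2) p.244 (bookkeeping)] -/
theorem isIntegrable_tower (h : τ.IsIntegrable) : v.tower.IsIntegrable :=
  fun p k hk => (h p k hk).congr (v.ae_eq p k hk).symm

end TowerRevision

end Generic

/-! ## §2. The version slot at the Stage-13 record (v1.8 `SepCoPHV`): `Revision₁₃`, the revised tower ∕ datum, the door, the face family, the adapter -/

variable (F : T4Family) (N : ℕ) [NeZero N]

/-- **THE VERSION SLOT OF THE STAGE-13 RECORD**: a revision of the tower of record `towerOfRecord₁₃SepCoPH F N θ h` — its level-`k ≥ 1` densities re-chosen within their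
`dV`-a.e. classes, level `0` verbatim.  The v1.7 provisos `Provisos₁₃SepCoPH` are UNCHANGED. [cite: Balaban1988Convergent, (2.18) p.257, Cor. 3 (2.50) p.264 (bookkeeping)] -/
abbrev Revision₁₃ (θ : Stage13HParams F N) (h : θ.Provisos₁₃SepCoPH F N) : Type :=
  TowerRevision (towerOfRecord₁₃SepCoPH F N θ h)

/-- The trivial revision of the record (the densities of record themselves). [cite: Balaban1988Convergent, (2.18) p.257 (bookkeeping)] -/
def Revision₁₃.refl (θ : Stage13HParams F N) (h : θ.Provisos₁₃SepCoPH F N) : Revision₁₃ F N θ h :=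
  TowerRevision.refl _

/-- (v1.8 `V`) **THE REVISED TOWER OF RECORD at `θ` under its Stage-13 provisos, version `v`**. [cite: Balaban1988Convergent, (0.2) p.244, (2.18) p.257, (3.25) p.270; Balaban1989LargeFieldI, (0.4) p.176 (bookkeeping)] -/
def towerOfRecord₁₃SepCoPHV (θ : Stage13HParams F N) (h : θ.Provisos₁₃SepCoPH F N) (v : Revision₁₃ F N θ h) :
    (coreOfRecord₁₃CoPH F N θ).Tower (avOfRecord F N) :=
  v.tower

/-- (v1.8 `V`) **THE DATUM OF RECORD, STAGE 13, VERSION `v`** — the datum of the core of record over the revised tower. [cite: Balaban1989LargeFieldII, Thm 1 + (0.1) pp.355–356; Balaban1988Convergent, (0.2) p.244 (bookkeeping)] -/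
def datumOfRecord₁₃SepCoPHV (θ : Stage13HParams F N) (h : θ.Provisos₁₃SepCoPH F N) (v : Revision₁₃ F N θ h) : FiniteEpsData F (SU N) :=
  datumOfTower F N (coreOfRecord₁₃CoPH F N θ) (towerOfRecord₁₃SepCoPHV F N θ h v)

/-- **THE DOOR, tower side** (`rfl`): at the trivial revision the revised tower IS the tower of record. [cite: Balaban1988Convergent, (0.2) p.244 (bookkeeping)] -/
theorem towerOfRecord₁₃SepCoPHV_refl (θ : Stage13HParams F N) (h : θ.Provisos₁₃SepCoPH F N) :
    towerOfRecord₁₃SepCoPHV F N θ h (Revision₁₃.refl F N θ h) = towerOfRecord₁₃SepCoPH F N θ h := rfl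

/-- **THE DOOR** (`rfl`): at the trivial revision the v1.8 datum IS the v1.7 datum of record `datumOfRecord₁₃SepCoPH F N θ h`. [cite: Balaban1989LargeFieldII, Thm 1 + (0.1) pp.355–356 (bookkeeping)] -/
theorem datumOfRecord₁₃SepCoPHV_refl (θ : Stage13HParams F N) (h : θ.Provisos₁₃SepCoPH F N) :
    datumOfRecord₁₃SepCoPHV F N θ h (Revision₁₃.refl F N θ h) = datumOfRecord₁₃SepCoPH F N θ h := rfl

section Faces

variable (θ : Stage13HParams F N) (h : θ.Provisos₁₃SepCoPH F N) (v : Revision₁₃ F N θ h)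

/-- (v1.8 `V`) FACE av (`rfl`): the averaging of record, every version. [cite: Balaban1987RG1, (0.4) p.253 (bookkeeping)] -/
theorem av_datumOfRecord₁₃SepCoPHV : (datumOfRecord₁₃SepCoPHV F N θ h v).av = avOfRecord F N := rfl

/-- (v1.8 `V`) STAGE-0 DATUM CLAUSE at the revised datum (`rfl`) — the clause the rung leaf `UV`'s `∃ D` reads. [cite: Balaban1987RG1, (0.3)–(0.4) p.253] -/
theorem isDatumOfRecord₀_datumOfRecord₁₃SepCoPHV : IsDatumOfRecord₀ F N (datumOfRecord₁₃SepCoPHV F N θ h v) := rfl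

/-- (v1.8 `V`) BINDER B1 = NODE N23 at the revised datum. [cite: Balaban1987RG1, (0.4) p.253] -/
theorem isPrintedAveraged_datumOfRecord₁₃SepCoPHV : (datumOfRecord₁₃SepCoPHV F N θ h v).IsPrintedAveraged :=
  isPrintedAveraged_datumOfTower F N _ _

/-- (v1.8 `V`) FACE construction (`rfl`): the Stage-13 core's construction over the re-chosen densities. [cite: Balaban1989LargeFieldII, Thm 1 + (0.1) pp.355–356 (bookkeeping)] -/
theorem datumOfRecord₁₃SepCoPHV_C : (datumOfRecord₁₃SepCoPHV F N θ h v).C = (coreOfRecord₁₃CoPH F N θ).construction v.ρ := rfl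

/-- (v1.8 `V`) … = the v1.7 construction of record with its `ρ` field UPDATED run by run (`rfl`; the B16-level re-choice shape `{C P with ρ := ρ′ P}`). [cite: Balaban1989LargeFieldII, Thm 1 + (0.1) pp.355–356 (bookkeeping)] -/
theorem datumOfRecord₁₃SepCoPHV_C_eq_update :
    (datumOfRecord₁₃SepCoPHV F N θ h v).C = fun P => { (datumOfRecord₁₃SepCoPH F N θ h).C P with ρ := v.ρ P } := rfl

/-- (v1.8 `V`) FACE `toB12` (`rfl`, EVERY version): the small-field part of the record is version-free — so is `DagBinding.EndpointExistence`. [cite: Balaban1987RG1, Thm 1 p.256 (bookkeeping)] -/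
theorem toB12_datumOfRecord₁₃SepCoPHV : (datumOfRecord₁₃SepCoPHV F N θ h v).C.toB12 = (datumOfRecord₁₃SepCoPH F N θ h).C.toB12 := rfl

/-- (v1.8 `V`) FACE β (`rfl`): the β-functions of record `betaOfRecord₁₃ θ`, every version. [cite: Balaban1987RG1, (1.20)–(1.22) p.264 (bookkeeping)] -/
theorem βfun_datumOfRecord₁₃SepCoPHV : (datumOfRecord₁₃SepCoPHV F N θ h v).βfun = betaOfRecord₁₃ F N θ.toStage13Params := rfl

/-- (v1.8 `V`) FACE flow (`rfl`): the run's coupling flow is the record's, every version. [cite: Balaban1987RG1, (0.17)–(0.20) pp.255–256 (bookkeeping)] -/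
theorem flow_datumOfRecord₁₃SepCoPHV (p : B12.RunParams) :
    ((datumOfRecord₁₃SepCoPHV F N θ h v).C p).flow = ((datumOfRecord₁₃SepCoPH F N θ h).C p).flow := rfl

/-- (v1.8 `V`) … so its couplings are `gOfRecord₁₃ θ p` (`rfl`). [cite: Balaban1987RG1, (0.17)–(0.20) pp.255–256 (bookkeeping)] -/
theorem flow_g_datumOfRecord₁₃SepCoPHV (p : B12.RunParams) :
    ((datumOfRecord₁₃SepCoPHV F N θ h v).C p).flow.g = gOfRecord₁₃ F N θ.toStage13Params p := rfl

/-- (v1.8 `V`) FACE `dens` (`rfl`): the revised datum's transported densities ARE the re-chosen `v.ρ`. [cite: Balaban1988Convergent, (0.2) p.244 (bookkeeping)] -/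
theorem dens_datumOfRecord₁₃SepCoPHV (K : ℕ) (g₀ : ℝ) (k : ℕ) : (datumOfRecord₁₃SepCoPHV F N θ h v).dens K g₀ k = v.ρ ⟨K, F.m, g₀⟩ k := rfl

/-- (v1.8 `V`) FACE Wilson start: at level `0` the revised datum's density IS the record's (never re-chosen). [cite: Balaban1988Convergent, Thm 1 p.262 (bookkeeping)] -/
theorem dens_zero_datumOfRecord₁₃SepCoPHV (K : ℕ) (g₀ : ℝ) :
    (datumOfRecord₁₃SepCoPHV F N θ h v).dens K g₀ 0 = (datumOfRecord₁₃SepCoPH F N θ h).dens K g₀ 0 :=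
  v.rho_zero_eq ⟨K, F.m, g₀⟩

/-- (v1.8 `V`) … and at every level `k ≤ K` it agrees with the record's `dV`-almost everywhere. [cite: Balaban1988Convergent, (0.2) p.244, (2.18) p.257 (bookkeeping)] -/
theorem dens_datumOfRecord₁₃SepCoPHV_ae (K : ℕ) (g₀ : ℝ) (k : ℕ) (hk : k ≤ K) :
    (datumOfRecord₁₃SepCoPHV F N θ h v).dens K g₀ k =ᵐ[fieldMeasure (F.P K) k (SU N)] (datumOfRecord₁₃SepCoPH F N θ h).dens K g₀ k :=
  v.ae_eq ⟨K, F.m, g₀⟩ k hk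

/-- (v1.8 `V`) FACE `Trho` (`rfl`): the realised `𝐓ρ_k` are `tdensOfRecord₁₃`, every version. [cite: Balaban1988Convergent, (3.25) p.270 (bookkeeping)] -/
theorem trho_datumOfRecord₁₃SepCoPHV (K : ℕ) (g₀ : ℝ) (k : ℕ) :
    (datumOfRecord₁₃SepCoPHV F N θ h v).real.Trho K g₀ k = tdensOfRecord₁₃ F N θ.toStage13Params ⟨K, F.m, g₀⟩ k := rfl

/-- (v1.8 `V`) FACE `𝐑`: the induced operation maps `𝐓ρ_k ↦` the re-chosen `ρ_{k+1}` — (0.2) holds BY CONSTRUCTION at the revised datum. [cite: Balaban1988Convergent, (0.2) p.244; Balaban1989LargeFieldI, (0.3) p.176 (bookkeeping)] -/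
theorem R_tdens_datumOfRecord₁₃SepCoPHV (K : ℕ) (g₀ : ℝ) (k : ℕ) :
    (datumOfRecord₁₃SepCoPHV F N θ h v).real.R K g₀ k (tdensOfRecord₁₃ F N θ.toStage13Params ⟨K, F.m, g₀⟩ k) = v.ρ ⟨K, F.m, g₀⟩ (k + 1) :=
  v.inducedR_tower_Trho ⟨K, F.m, g₀⟩ k

/-- (v1.8 `V`) FACE χ ∕ actions ∕ `IndAss` ∕ `Repr`: the record's, every version (`rfl`). [cite: Balaban1987RG1, (0.17)–(0.24) pp.255–257 (bookkeeping)] -/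
theorem actionSide_datumOfRecord₁₃SepCoPHV (p : B12.RunParams) (k : ℕ) :
    ((datumOfRecord₁₃SepCoPHV F N θ h v).C p).χ k = ((datumOfRecord₁₃SepCoPH F N θ h).C p).χ k ∧
      ((datumOfRecord₁₃SepCoPHV F N θ h v).C p).effAction k = ((datumOfRecord₁₃SepCoPH F N θ h).C p).effAction k ∧
        ((datumOfRecord₁₃SepCoPHV F N θ h v).C p).Ek k = ((datumOfRecord₁₃SepCoPH F N θ h).C p).Ek k ∧
          (((datumOfRecord₁₃SepCoPHV F N θ h v).C p).IndAss k ↔ ((datumOfRecord₁₃SepCoPH F N θ h).C p).IndAss k) ∧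
            (((datumOfRecord₁₃SepCoPHV F N θ h v).C p).Repr k ↔ ((datumOfRecord₁₃SepCoPH F N θ h).C p).Repr k) :=
  ⟨rfl, rfl, rfl, Iff.rfl, Iff.rfl⟩

/-- (v1.8 `V`) FACE `Sect2Form` (`Iff.rfl`): the §2 [III] CLAUSE is the record's at every version (Theorem 1 speaks of θ's represented densities). [cite: Balaban1988Convergent, (2.17)–(2.18) p.257, Thm 1 p.262 (bookkeeping)] -/
theorem sect2Form_datumOfRecord₁₃SepCoPHV_iff (p : B12.RunParams) (k : ℕ) :
    ((datumOfRecord₁₃SepCoPHV F N θ h v).C p).Sect2Form k ↔ ((datumOfRecord₁₃SepCoPH F N θ h).C p).Sect2Form k := Iff.rfl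

/-- (v1.8 `V`) **[V] THEOREM 1 IS VERSION-FREE** (`Iff.rfl`): `B16.Thm1Printed` reads `flow` and the `Sect2Form` clause only. [cite: Balaban1989LargeFieldII, Thm 1 p.355 (bookkeeping)] -/
theorem thm1Printed_datumOfRecord₁₃SepCoPHV_iff :
    B16.Thm1Printed (datumOfRecord₁₃SepCoPHV F N θ h v).C ↔ B16.Thm1Printed (datumOfRecord₁₃SepCoPH F N θ h).C := Iff.rfl

/-- (v1.8 `V`) **ENDPOINT EXISTENCE IS VERSION-FREE** (`Iff.rfl`). [cite: Balaban1987RG1, Thm 2 p.259 (bookkeeping)] -/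
theorem endpointExistence_datumOfRecord₁₃SepCoPHV_iff :
    EndpointExistence (datumOfRecord₁₃SepCoPHV F N θ h v).C.toB12 ↔ EndpointExistence (datumOfRecord₁₃SepCoPH F N θ h).C.toB12 := Iff.rfl

/-- (v1.8 `V`) FACE tuning (`Iff.rfl`): `FiniteEpsData.Tuned` reads `flow` only. [cite: Balaban1987RG1, Thm 2 p.259 (bookkeeping)] -/
theorem tuned_datumOfRecord₁₃SepCoPHV_iff (γ g : ℝ) (g₀ : ℕ → ℝ) :
    (datumOfRecord₁₃SepCoPHV F N θ h v).Tuned γ g g₀ ↔ (datumOfRecord₁₃SepCoPH F N θ h).Tuned γ g g₀ := Iff.rfl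

/-- (v1.8 `V`) FACE observables (`rfl`): the averaged loop variables read `av` only. [cite: Balaban1989LargeFieldII, (0.1) p.356 (bookkeeping)] -/
theorem avgObs_datumOfRecord₁₃SepCoPHV : (datumOfRecord₁₃SepCoPHV F N θ h v).avgObs = (datumOfRecord₁₃SepCoPH F N θ h).avgObs := rfl

/-- (v1.8 `V`) FACE scheme (`rfl`): the Wilson scheme of finite-ε expectations is version-free (it reads `F.P`, the bare couplings and `av`). [cite: JaffeWittenClay2006, §6.5 p.11 (bookkeeping)] -/
theorem scheme_datumOfRecord₁₃SepCoPHV (g₀ : ℕ → ℝ) : (datumOfRecord₁₃SepCoPHV F N θ h v).scheme g₀ = (datumOfRecord₁₃SepCoPH F N θ h).scheme g₀ := rfl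

/-- (v1.8 `V`) **THE TARGETS' PREFIX AT THE REVISED DATUM** (`Iff.rfl`): ANTECEDENT = (B) pinned at the REVISED datum (ρ-pointwise through Cor. 3), BODY = the record's (version-free). [cite: Balaban1987RG1, Thm 2 p.259 (bookkeeping)] -/
theorem underHypotheses_datumOfRecord₁₃SepCoPHV_iff (Hβ : Prop) (concl : (ℕ → ℝ) → Prop) :
    (datumOfRecord₁₃SepCoPHV F N θ h v).UnderHypotheses Hβ concl ↔
      (B16.EndStatementBPrinted (datumOfRecord₁₃SepCoPHV F N θ h v).C → Hβ →
        ∃ γ₀ : ℝ, 0 < γ₀ ∧ ∀ γ : ℝ, 0 < γ → γ ≤ γ₀ → ∃ g₁ : ℝ, 0 < g₁ ∧ ∀ g : ℝ, 0 < g → g ≤ g₁ →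
          ∀ g₀ : ℕ → ℝ, (datumOfRecord₁₃SepCoPH F N θ h).Tuned γ g g₀ → concl g₀) := Iff.rfl

/-- (v1.8 `V`) **THE HYBRID-NE7 SPINE UNDER A PREFIX AT THE REVISED DATUM** (`Iff.rfl`): `T4ApexHybrid.HybridNE7Under (datumOfRecord₁₃SepCoPHV … v) Hβ` IS «(B) at the revised
datum → `Hβ` → the record's tuned-window body over the record's Wilson schemes» — the body is version-free, the antecedent is not (hence the rung's K3 item is keyed AT the slot). [cite: Balaban1989LargeFieldII, (0.1) p.356; Balaban1987RG1, Thm 2 p.259 (bookkeeping)] -/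
theorem hybridNE7Under_datumOfRecord₁₃SepCoPHV_iff (Hβ : Prop) :
    T4ApexHybrid.HybridNE7Under (datumOfRecord₁₃SepCoPHV F N θ h v) Hβ ↔
      (B16.EndStatementBPrinted (datumOfRecord₁₃SepCoPHV F N θ h v).C → Hβ →
        ∃ γ₀ : ℝ, 0 < γ₀ ∧ ∀ γ : ℝ, 0 < γ → γ ≤ γ₀ → ∃ g₁ : ℝ, 0 < g₁ ∧ ∀ g : ℝ, 0 < g → g ≤ g₁ →
          ∀ g₀ : ℕ → ℝ, (datumOfRecord₁₃SepCoPH F N θ h).Tuned γ g g₀ →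
            T4ApexHybrid.StringwiseHybridNE7 ((datumOfRecord₁₃SepCoPH F N θ h).scheme g₀)) := Iff.rfl

/-- (v1.8 `V`) FACE integrability: every density of the revised datum, `k ≤ K`, is integrable (the record's tower is, `isIntegrable_towerOfRecord₁₃SepCoPH`; `Integrable.congr`). [cite: Balaban1988Convergent, (0.2) p.244 (bookkeeping)] -/
theorem integrable_dens_datumOfRecord₁₃SepCoPHV (K : ℕ) (g₀ : ℝ) (k : ℕ) (hk : k ≤ K) :
    Integrable ((datumOfRecord₁₃SepCoPHV F N θ h v).dens K g₀ k) (fieldMeasure (F.P K) k (SU N)) :=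
  v.isIntegrable_tower (isIntegrable_towerOfRecord₁₃SepCoPH F N θ h) ⟨K, F.m, g₀⟩ k hk

/-- (v1.8 `V`) `∫ρ_k = ∫ρ₀` along every run of the revised datum, `k ≤ K` (`Tower.integral_eq_integral_zero`). [cite: Balaban1985UV3, (6) p.257] -/
theorem integral_dens_eq_zero_datumOfRecord₁₃SepCoPHV (K : ℕ) (g₀ : ℝ) (k : ℕ) (hk : k ≤ K) :
    ∫ V, (datumOfRecord₁₃SepCoPHV F N θ h v).dens K g₀ k V ∂fieldMeasure (F.P K) k (SU N)
      = ∫ U, (datumOfRecord₁₃SepCoPHV F N θ h v).dens K g₀ 0 U ∂fieldMeasure (F.P K) 0 (SU N) :=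
  (towerOfRecord₁₃SepCoPHV F N θ h v).integral_eq_integral_zero ⟨K, F.m, g₀⟩ k hk

/-- (v1.8 `V`) The T⁴ apex at the revised datum, B1 eliminated. [cite: JaffeWittenClay2006, §6.5 p.11] -/
theorem continuumYM4Torus_datumOfRecord₁₃SepCoPHV
    (hB : B16.EndStatementBPrinted (datumOfRecord₁₃SepCoPHV F N θ h v).C)
    (hE : EndpointExistence (datumOfRecord₁₃SepCoPHV F N θ h v).C.toB12)
    (hNE : T4ApexHybrid.HybridNE7Under (datumOfRecord₁₃SepCoPHV F N θ h v) (EndpointExistence (datumOfRecord₁₃SepCoPHV F N θ h v).C.toB12)) :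
    T4ContinuumYM4Torus.ContinuumYM4Torus (datumOfRecord₁₃SepCoPHV F N θ h v) :=
  continuumYM4Torus_datumOfTower F N _ _ hB hE hNE

end Faces

/-! ### The adapters: «∃ an a.e. re-choice of the record's densities with property `Q`» ⇒ «∃ a version `v` with `Q` at the revised datum» -/

/-- (v1.8 `V`) **THE ADAPTER, construction-update form** (director-ym №210 (A)(1), datum-level half of the DATUM-SURGERY lemma): if SOME density family `ρ′` — equal to the
record's at level `0`, `dV`-a.e. equal at every positive level the run reads — gives the UPDATED construction `fun P => {(datumOfRecord₁₃SepCoPH F N θ h).C P with ρ := ρ′ P}`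
a property `Q`, then SOME version `v` gives the revised datum's construction the property `Q` (the two constructions are the same term, `datumOfRecord₁₃SepCoPHV_C_eq_update`).
With `Q := B16.EndStatementBPrinted` and a B16-level «(B) a.e. ⇒ (B) as typed up to an a.e. re-choice keeping level 0» lemma (Summits-side), this is the revised K1
(B)-conjunct `∃ v, B16.EndStatementBPrinted (datumOfRecord₁₃SepCoPHV F N θ h v).C`.  (A family a.e.-equal at EVERY positive level qualifies a fortiori: feed `fun P k _ => hae P k`.) [cite: Balaban1988Convergent, Cor. 3 (2.50) p.264 (bookkeeping)] -/
theorem exists_revision₁₃_of_exists_update (θ : Stage13HParams F N) (h : θ.Provisos₁₃SepCoPH F N) (Q : B16.Construction → Prop)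
    (hex : ∃ ρ' : (P : B12.RunParams) → (k : ℕ) → ((datumOfRecord₁₃SepCoPH F N θ h).C P).Cfg k → ℝ,
      (∀ P : B12.RunParams, ρ' P 0 = ((datumOfRecord₁₃SepCoPH F N θ h).C P).ρ 0) ∧
        (∀ (P : B12.RunParams) (k : ℕ), k < P.K →
          ρ' P (k + 1) =ᵐ[fieldMeasure (F.P P.K) (k + 1) (SU N)] ((datumOfRecord₁₃SepCoPH F N θ h).C P).ρ (k + 1)) ∧
          Q (fun P => { (datumOfRecord₁₃SepCoPH F N θ h).C P with ρ := ρ' P })) :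
    ∃ v : Revision₁₃ F N θ h, Q (datumOfRecord₁₃SepCoPHV F N θ h v).C := by
  obtain ⟨ρ', h0, hae, hQ⟩ := hex
  exact ⟨⟨ρ', h0, hae⟩, hQ⟩

/-- (v1.8 `V`) The adapter at `Q := B16.EndStatementBPrinted` — the shape of the revised K1 (B)-conjunct. [cite: Balaban1989LargeFieldII, Thm 1 p.355; Balaban1988Convergent, Cor. 3 (2.50) p.264 (bookkeeping)] -/
theorem exists_revision₁₃_endStatementBPrinted_of_exists_update (θ : Stage13HParams F N) (h : θ.Provisos₁₃SepCoPH F N)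
    (hex : ∃ ρ' : (P : B12.RunParams) → (k : ℕ) → ((datumOfRecord₁₃SepCoPH F N θ h).C P).Cfg k → ℝ,
      (∀ P : B12.RunParams, ρ' P 0 = ((datumOfRecord₁₃SepCoPH F N θ h).C P).ρ 0) ∧
        (∀ (P : B12.RunParams) (k : ℕ), k < P.K →
          ρ' P (k + 1) =ᵐ[fieldMeasure (F.P P.K) (k + 1) (SU N)] ((datumOfRecord₁₃SepCoPH F N θ h).C P).ρ (k + 1)) ∧
          B16.EndStatementBPrinted (fun P => { (datumOfRecord₁₃SepCoPH F N θ h).C P with ρ := ρ' P })) :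
    ∃ v : Revision₁₃ F N θ h, B16.EndStatementBPrinted (datumOfRecord₁₃SepCoPHV F N θ h v).C :=
  exists_revision₁₃_of_exists_update F N θ h B16.EndStatementBPrinted hex

/-- (v1.8 `V`) **THE ADAPTER, tower form**: if SOME explicit density tower `τ′` of the Stage-13 core along the averaging of record — equal to the tower of record at level `0`,
`dV`-a.e. equal at every positive level the run reads (its `Tρ_k` and obligations are NOT read) — gives the core's construction over `τ′.ρ` a property `Q`, then SOME version
`v` gives the revised datum's construction the property `Q` (`(datumOfRecord₁₃SepCoPHV F N θ h v).C = construction v.ρ`, `rfl`). [cite: Balaban1988Convergent, Cor. 3 (2.50) p.264 (bookkeeping)] -/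
theorem exists_revision₁₃_of_exists_tower (θ : Stage13HParams F N) (h : θ.Provisos₁₃SepCoPH F N) (Q : B16.Construction → Prop)
    (hex : ∃ τ' : (coreOfRecord₁₃CoPH F N θ).Tower (avOfRecord F N),
      (∀ p : B12.RunParams, τ'.ρ p 0 = (towerOfRecord₁₃SepCoPH F N θ h).ρ p 0) ∧
        (∀ (p : B12.RunParams) (k : ℕ), k < p.K →
          τ'.ρ p (k + 1) =ᵐ[fieldMeasure (F.P p.K) (k + 1) (SU N)] (towerOfRecord₁₃SepCoPH F N θ h).ρ p (k + 1)) ∧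
          Q ((coreOfRecord₁₃CoPH F N θ).construction τ'.ρ)) :
    ∃ v : Revision₁₃ F N θ h, Q (datumOfRecord₁₃SepCoPHV F N θ h v).C := by
  obtain ⟨τ', h0, hae, hQ⟩ := hex
  exact ⟨⟨τ'.ρ, h0, hae⟩, hQ⟩

/-- (v1.8 `V`) Conversely every version IS such a re-choice: the slot adds nothing beyond «level-0 equation ∧ positive-level a.e.». [cite: Balaban1988Convergent, Cor. 3 (2.50) p.264 (bookkeeping)] -/
theorem exists_update_of_exists_revision₁₃ (θ : Stage13HParams F N) (h : θ.Provisos₁₃SepCoPH F N) (Q : B16.Construction → Prop)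
    (hex : ∃ v : Revision₁₃ F N θ h, Q (datumOfRecord₁₃SepCoPHV F N θ h v).C) :
    ∃ ρ' : (P : B12.RunParams) → (k : ℕ) → ((datumOfRecord₁₃SepCoPH F N θ h).C P).Cfg k → ℝ,
      (∀ P : B12.RunParams, ρ' P 0 = ((datumOfRecord₁₃SepCoPH F N θ h).C P).ρ 0) ∧
        (∀ (P : B12.RunParams) (k : ℕ), k < P.K →
          ρ' P (k + 1) =ᵐ[fieldMeasure (F.P P.K) (k + 1) (SU N)] ((datumOfRecord₁₃SepCoPH F N θ h).C P).ρ (k + 1)) ∧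
          Q (fun P => { (datumOfRecord₁₃SepCoPH F N θ h).C P with ρ := ρ' P }) := by
  obtain ⟨v, hQ⟩ := hex
  exact ⟨v.ρ, v.rho_zero_eq, v.ae_eq_succ, hQ⟩

/-- (v1.8 `V`) **«∃ datum of record, Stage 0, with (B), END and the spine» ⟸ the three at SOME version of the Stage-13 record** — the tuple the rung leaf's `∃ D` reads, presented
at the revised datum (`IsDatumOfRecord₀` by `rfl`). [cite: Balaban1989LargeFieldII, Thm 1 + (0.1) pp.355–356 (bookkeeping)] -/
theorem exists_datumOfRecord₀_spine_of_revision₁₃ (θ : Stage13HParams F N) (h : θ.Provisos₁₃SepCoPH F N) (v : Revision₁₃ F N θ h)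
    (hB : B16.EndStatementBPrinted (datumOfRecord₁₃SepCoPHV F N θ h v).C)
    (hE : EndpointExistence (datumOfRecord₁₃SepCoPHV F N θ h v).C.toB12)
    (hNE : T4ApexHybrid.HybridNE7Under (datumOfRecord₁₃SepCoPHV F N θ h v) (EndpointExistence (datumOfRecord₁₃SepCoPHV F N θ h v).C.toB12)) :
    ∃ D : FiniteEpsData F (SU N), IsDatumOfRecord₀ F N D ∧ B16.EndStatementBPrinted D.C ∧ EndpointExistence D.C.toB12 ∧
      T4ApexHybrid.HybridNE7Under D (EndpointExistence D.C.toB12) :=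
  ⟨datumOfRecord₁₃SepCoPHV F N θ h v, isDatumOfRecord₀_datumOfRecord₁₃SepCoPHV F N θ h v, hB, hE, hNE⟩

end Literature.MathematicalPhysics.QuantumFieldTheory.Balaban1983to89.Node00

end
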